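import Literature.Probability.RandomPlanarGeometry.HexParafermion
import Literature.Probability.RandomPlanarGeometry.HexSAW
import Literature.Probability.RandomPlanarGeometry.CurveTortuosity
import Literature.Barriers.CriticalPhenomena.ParafermionicHalfCauchyRiemann

/-!
# Objects of the line `marginal-reflex-wedge-cauchy-kernel` for the crux `HexConjecture` (stmt-CriticalPhenomena-0808)

Lead prover `prover-line-stmt-CriticalPhenomena-0808-0` (crux protocol; skeleton
`Summits/CriticalPhenomena/SAWScalingLimit/Cruxes/HexConjecture/Lines/marginal-reflex-wedge-cauchy-kernel.lean`,
planner `planner-cruxplan-stmt-CriticalPhenomena-0808-marginal-reflex-wedg-0`). This file only DEFINES the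
finite lattice objects the line's stubs speak about, so that the stub files under `Theorems/` and the lead's
skeleton share ONE copy of them (precedent: `SAWDevelopingMapHexTightReversalDefs.lean`). No statement of the
line is asserted or named here.

The geometry (honeycomb lattice `hexGraph` embedded by `hexCenter`, apex = the hexagon centre `0`):
* `cornerIn`, `cornerOut`, `cornerEdge` — the ROOT mid-edge `a = {cornerIn, cornerOut}`: the vertical edge
  of `ℍ` crossing the positive real axis at `1/2` (`cornerIn` at `1/2 - i/(2√3)`, `cornerOut` at
  `1/2 + i/(2√3)`);
* `InSector z` — the removed CLOSED `60°` sector `0 ≤ arg z ≤ π/3` (no honeycomb vertex lies on either ray);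
* `IsReflexWedgeTruncation Λ N` — `Λ = W_N`, the truncated `300°` lattice wedge: the vertices `v` with
  `‖c_v‖ < N` outside the closed sector;
* `dartSum Λ P f` — the sum of `f v w` over the boundary darts `(v, w)` of `Λ` (`v ∈ Λ`, `w ∼ v`, `w ∉ Λ`)
  selected by `P`, indexed exactly like the barrier file's `HexGreen.hexFlux`;
* `IsArcDart N`, `IsRayZeroDart N`, `IsRaySixtyDart N` — the three classes of non-root boundary darts of
  `W_N` (outer vertex beyond radius `N`; outer vertex in the sector with inner vertex below the `0°`-ray,
  the root excluded; outer vertex in the sector with inner vertex beyond the `60°`-ray);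
* `Fc Λ σ` — the parafermionic observable of `Λ` rooted at `cornerEdge` at `x = x_c`, spin `σ`;
  `Zm Λ a z` — the `x_c`-mass `Σ_{γ ⊂ Λ : a → z} x_c^{ℓ(γ)}`;
* `farFlux Λ N`, `rayZeroMass Λ N`, `raySixtyMass Λ N` — the arc flux `Σ_arc (z - v_z) F(z)` and the two
  ray masses `Σ ‖F‖` of the corner-rooted critical observable (`σ = 5/8`);
* `hexPolyline γ` — the polyline of a SAW of `Ω_δ ⊂ δℍ` as a parametrised curve (`γ.curve` is its class,
  `mk_hexPolyline`).

Sources: H. Duminil-Copin, S. Smirnov, Ann. of Math. 175 (2012) (arXiv:1007.0575) §2–3 (mid-edge walks,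
observable, Lemma 1 and the boundary evaluation in the proof of Lemma 2); M. Aizenman, A. Burchard, Duke
Math. J. 99 (1999) §1.b (traversals of shells by the polyline). Deliberately NOT here: the line's statements
(`ReflexFluxLine`, `ConeExteriorEscape`, `ReflexCellCeiling`, `HexTraversalBound`, …) and any theorem beyond
the `rfl` sanity lemma `mk_hexPolyline`.
-/

noncomputable section

open scoped BigOperators Classical
open Literature.Probability.LatticeModels Literature.Probability.RandomPlanarGeometry
  Literature.Probability.RandomPlanarGeometry.SAW
open Literature.Barriers.CriticalPhenomena.HexGreen (nbrs)

namespace Summit.CriticalPhenomena.SAWScalingLimit.Theorems.HexConjecture.MarginalWedge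

/-- Inner endpoint of the corner (root) edge: the down-face of the cell `(0,-1)`, centre `1/2 - i/(2√3)`
(argument `-30°`, inside the `300°` wedge). -/
def cornerIn : HexVertex := ((![0, -1] : Site 2), (1 : Fin 2))

/-- Outer endpoint of the corner edge: the up-face of the cell `(0,0)`, centre `1/2 + i/(2√3)` (argument
`+30°`, in the removed `60°` sector). -/
def cornerOut : HexVertex := ((![0, 0] : Site 2), (0 : Fin 2))

/-- The root `a`: the vertical mid-edge at `1/2` on the `0°`-ray of the `300°` wedge with apex the hexagon
centre `0`. -/
def cornerEdge : Sym2 HexVertex := s(cornerIn, cornerOut)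

/-- The removed CLOSED `60°` sector `0 ≤ arg z ≤ π/3`. -/
def InSector (z : ℂ) : Prop := 0 ≤ Complex.arg z ∧ Complex.arg z ≤ Real.pi / 3

/-- `Λ` is the truncated marginal reflex wedge `W_N`: the honeycomb vertices at distance `< N` from the
apex whose centre is outside the closed sector. -/
def IsReflexWedgeTruncation (Λ : Finset HexVertex) (N : ℝ) : Prop :=
  ∀ v : HexVertex, v ∈ Λ ↔ ‖hexCenter v‖ < N ∧ ¬ InSector (hexCenter v)

/-- Sum of `f v w` over the boundary darts `(v, w)` of `Λ` (`v ∈ Λ`, `w ∼ v` in `ℍ`, `w ∉ Λ`; the boundary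
mid-edge is `s(v, w)` and `v` its inner vertex) selected by the predicate `P`. Same indexing as
`HexGreen.hexFlux Λ F = Σ_{v ∈ Λ} Σ_{w ∈ nbrs v, w ∉ Λ} (mid - c_v) F`. -/
def dartSum {M : Type*} [AddCommMonoid M] (Λ : Finset HexVertex)
    (P : HexVertex → HexVertex → Prop) (f : HexVertex → HexVertex → M) : M :=
  ∑ v ∈ Λ, ∑ w ∈ (nbrs v).filter (fun w => w ∉ Λ ∧ P v w), f v w

/-- ARC darts of `W_N`: the outer vertex lies outside the open disc of radius `N`. -/
def IsArcDart (N : ℝ) (_v w : HexVertex) : Prop := N ≤ ‖hexCenter w‖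

/-- Darts of `W_N` crossing the `0°`-RAY other than the root: outer vertex inside the disc (hence in the
sector), inner vertex below the positive real axis (`arg c_v < 0`). -/
def IsRayZeroDart (N : ℝ) (v w : HexVertex) : Prop :=
  ‖hexCenter w‖ < N ∧ Complex.arg (hexCenter v) < 0 ∧ (v, w) ≠ (cornerIn, cornerOut)

/-- Darts of `W_N` crossing the `60°`-RAY: outer vertex inside the disc (hence in the sector), inner vertex
beyond the ray (`π/3 < arg c_v`). -/
def IsRaySixtyDart (N : ℝ) (v w : HexVertex) : Prop :=
  ‖hexCenter w‖ < N ∧ Real.pi / 3 < Complex.arg (hexCenter v)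

/-- The parafermionic observable of `Λ` rooted at the corner edge at the critical fugacity `x_c`, spin `σ`
(`σ = 5/8`: DCS's `F`; `σ = 0`: the mass). -/
def Fc (Λ : Finset HexVertex) (σ : ℝ) (z : Sym2 HexVertex) : ℂ :=
  hexParafermionicObservable Λ cornerEdge hexCriticalFugacity σ z

/-- The `x_c`-mass `Z_Λ(a → z) = Σ_{γ ⊂ Λ : a → z} x_c^{ℓ(γ)}` of the walks of `Λ` between two mid-edges
(`= F` at spin `0`, `hexParafermionicObservable_zero_spin`; `≥ ‖F‖`, `norm_hexParafermionicObservable_le`). -/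
def Zm (Λ : Finset HexVertex) (a z : Sym2 HexVertex) : ℝ :=
  ∑ γ : HexMidEdgeSAW Λ a z, hexCriticalFugacity ^ γ.length

/-- The far flux `Φ_N := Σ_{arc darts (v, w)} (mid s(v,w) - c_v) F(s(v,w))` of the corner-rooted critical
observable (`σ = 5/8`). -/
def farFlux (Λ : Finset HexVertex) (N : ℝ) : ℂ :=
  dartSum Λ (IsArcDart N) fun v w => (hexMidpoint s(v, w) - hexCenter v) * Fc Λ (5 / 8) s(v, w)

/-- The ray mass `Z₀^{(N)} := Σ_{0°-ray darts} ‖F‖` of the corner-rooted critical observable. -/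
def rayZeroMass (Λ : Finset HexVertex) (N : ℝ) : ℝ :=
  dartSum Λ (IsRayZeroDart N) fun v w => ‖Fc Λ (5 / 8) s(v, w)‖

/-- The ray mass `Z₆₀^{(N)} := Σ_{60°-ray darts} ‖F‖` of the corner-rooted critical observable. -/
def raySixtyMass (Λ : Finset HexVertex) (N : ℝ) : ℝ :=
  dartSum Λ (IsRaySixtyDart N) fun v w => ‖Fc Λ (5 / 8) s(v, w)‖

/-- The polyline of a SAW of `Ω_δ ⊂ δℍ` as a parametrised curve through the rescaled centres of its
vertices (its class is the route observable `γ.curve`, `mk_hexPolyline`). -/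
def hexPolyline {Ω : Set ℂ} {δ : ℝ} {a b : HexVertex} (γ : HexDomainSAW Ω δ a b) : Curve ℂ :=
  ⟨γ.walk.toCurve fun v => (δ : ℂ) * hexCenter v⟩

/-- Sanity: the class of `hexPolyline γ` is `γ.curve` (definitionally). Registered sub-goal `mk_hexPolyline`
of the crux skeleton (this objects file carries it). -/
theorem mk_hexPolyline : ∀ {Ω : Set ℂ} {δ : ℝ} {a b : HexVertex} (γ : HexDomainSAW Ω δ a b), CurveClass.mk (hexPolyline γ) = γ.curve :=
  fun _ => rfl

end Summit.CriticalPhenomena.SAWScalingLimit.Theorems.HexConjecture.MarginalWedge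

end
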